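import Summits.PneNP.PneNP.Theorems.KarlinRubinMonotoneBlindSwitchSmall
import Summits.PneNP.PneNP.Theorems.KarlinRubinMonotoneBlindSwitch
import Summits.PneNP.PneNP.Theorems.KarlinRubinMonotoneBlindFormIterDefs

/-!
# Route KarlinRubin, crux `MonotoneBlind` (stmt-PneNP-18027): constant depth — bounds for one level of reduction

Stage C of the AC⁰ line (seat write-up `MonotoneBlind_AC0_announce.md`). For a level-`(d+2)` formula `f` with fan-ins
`≤ M` and level-`0` sets of `≤ L` slots, and the restriction `(V₁, x)`:

* `length_swLeaves_le`, `swLeaves_bnd` — `f` has `≤ M^{d+1}` depth-2 sub-formulas, each with `≤ M` sets of `≤ L` slots;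
* the GOOD event: every canonical run of every depth-2 sub-formula (on `x`, or on `¬x` for the DNF ones) meets `< v₀`
  vertices of `V₁`; then (`swBnd_swReduce`) the reduced formula has fan-ins `≤ M 2^r` and sets of `≤ r` slots,
  `r = C(v₀-1,2)` (`card_swDnf_le_of_good`);
* `swReduce_bad_count` — **the bad event is rare**: summed over the `n₁`-subsets `V₁ ⊆ V`, the inputs outside the good
  event number at most `M^{d+1}` times the bound of the switching lemma (`switch_bad_count`).

All `--supports stmt-PneNP-18027`; no definitions (the bad event `swBadAt` is in `…FormIterDefs`).
-/

set_option linter.dupNamespace false -- `Summit.PneNP.PneNP.…`: summit = sub-problem (D-0017)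

namespace Summit.PneNP.PneNP.Theorems

open Finset
open Literature.Computability.Complexity
open Literature.Probability.RandomGraphs.PlantedClique

variable {n : ℕ}

/-! ### The depth-2 sub-formulas -/

/-- A bounded level-`(d+1)` formula has at most `M^d` depth-2 sub-formulas. [folklore] -/
theorem length_swLeaves_le (M L : ℕ) :
    ∀ (d : ℕ) (pol : Bool) (f : swForm n (d + 1)), swBnd M L (d + 1) f → (swLeaves d pol f).length ≤ M ^ d := by
  intro d
  induction d with
  | zero => intro pol f _; rw [swLeaves_zero', List.length_singleton, pow_zero]
  | succ d ih =>
    intro pol f hf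
    rw [swLeaves_succ, List.length_flatMap]
    rw [swBnd_succ] at hf
    obtain ⟨hlen, hkids⟩ := hf
    calc (f.kids.map fun g => (swLeaves d (!pol) g).length).sum
        ≤ (f.kids.map fun _ => M ^ d).sum := by
          refine List.sum_le_sum ?_
          intro g hg
          exact ih (!pol) g (hkids g hg)
      _ = f.kids.length * M ^ d := by rw [List.map_const', List.sum_replicate, smul_eq_mul]
      _ ≤ M * M ^ d := Nat.mul_le_mul_right _ hlen
      _ = M ^ (d + 1) := by ring

/-- The depth-2 sub-formulas of a bounded formula are bounded: `≤ M` sets of `≤ L` slots each. [folklore] -/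
theorem swLeaves_bnd (M L : ℕ) :
    ∀ (d : ℕ) (pol : Bool) (f : swForm n (d + 1)), swBnd M L (d + 1) f →
      ∀ p ∈ swLeaves d pol f, p.2.length ≤ M ∧ ∀ S ∈ p.2, #S ≤ L := by
  intro d
  induction d with
  | zero =>
    intro pol f hf p hp
    rw [swLeaves_zero', List.mem_singleton] at hp
    subst hp
    exact (swBnd_one M L f).1 hf
  | succ d ih =>
    intro pol f hf p hp
    rw [swLeaves_succ, List.mem_flatMap] at hp
    obtain ⟨g, hg, hp⟩ := hp
    rw [swBnd_succ] at hf
    exact ih (!pol) g (hf.2 g hg) p hp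

/-- The depth-2 sub-formulas of a formula inside `V` are inside `V`. [folklore] -/
theorem swLeaves_inside (V : Finset (Fin n)) :
    ∀ (d : ℕ) (pol : Bool) (f : swForm n (d + 1)), swIn V (d + 1) f →
      ∀ p ∈ swLeaves d pol f, ∀ S ∈ p.2, ∀ e ∈ S, ∀ v ∈ (e : Sym2 (Fin n)), v ∈ V := by
  intro d
  induction d with
  | zero =>
    intro pol f hf p hp
    rw [swLeaves_zero', List.mem_singleton] at hp
    subst hp
    exact (swIn_one V f).1 hf
  | succ d ih =>
    intro pol f hf p hp
    rw [swLeaves_succ, List.mem_flatMap] at hp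
    obtain ⟨g, hg, hp⟩ := hp
    rw [swIn_succ] at hf
    exact ih (!pol) g (hf g hg) p hp

/-! ### The reduced formula is bounded on the good event -/

open Classical in
/-- **On the good event the reduced formula is bounded**: fan-ins `≤ M 2^r`, sets of `≤ r = C(v₀-1,2)` slots.
[cite: Beame1994, §3] -/
theorem swBnd_swReduce (V₁ : Finset (Fin n)) (x : EdgeVec n) (M L v₀ : ℕ) :
    ∀ (d : ℕ) (pol : Bool) (f : swForm n (d + 2)), swBnd M L (d + 2) f →
      (∀ p ∈ swLeaves (d + 1) pol f, ∀ z : EdgeVec n, #(univ.filter fun v : Fin n =>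
        ∃ e ∈ (swRun V₁ (if p.1 then (fun e => !x e) else x) z p.2 ∅).2, v ∈ (e : Sym2 (Fin n))) < v₀) →
      swBnd (M * 2 ^ (v₀ - 1).choose 2) ((v₀ - 1).choose 2) (d + 1) (swReduce V₁ x d pol f) := by
  set r := (v₀ - 1).choose 2 with hr
  intro d
  induction d with
  | zero =>
    intro pol f hf hgood
    rw [swBnd_succ] at hf
    obtain ⟨hlen, hkids⟩ := hf
    -- the leaves of `f` are its children, with polarity `!pol`
    have hleaf : ∀ c ∈ f.kids, (!pol, c.clauses) ∈ swLeaves 1 pol f := by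
      intro c hc
      rw [swLeaves_succ, List.mem_flatMap]
      exact ⟨c, hc, by rw [swLeaves_zero']; exact List.mem_singleton_self _⟩
    cases pol
    · rw [swReduce_zero_false', swBnd_succ]
      simp only [swForm.kids, swForm.node, List.mem_flatMap, List.mem_map, Finset.mem_toList, List.length_flatMap]
      have hg : ∀ c ∈ f.kids, (∀ T ∈ swDnf V₁ (fun e => !x e) c.clauses, #T ≤ r) ∧
          #(swDnf V₁ (fun e => !x e) c.clauses) ≤ 2 ^ r := by
        intro c hc
        have h := hgood _ (hleaf c hc)
        simp only [Bool.not_false, if_true] at h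
        exact ⟨(swDnf_bnd_of_good V₁ _ c.clauses v₀ h).1, card_swDnf_le_of_good V₁ _ c.clauses v₀ h⟩
      refine ⟨?_, ?_⟩
      · calc (f.kids.map fun c => (((swDnf V₁ (fun e => !x e) c.clauses).toList.map swForm.leaf).length)).sum
            ≤ (f.kids.map fun _ => 2 ^ r).sum := by
              refine List.sum_le_sum fun c hc => ?_
              rw [List.length_map, Finset.length_toList]
              exact (hg c hc).2
          _ = f.kids.length * 2 ^ r := by
              rw [List.map_const', List.sum_replicate, smul_eq_mul]
          _ ≤ M * 2 ^ r := Nat.mul_le_mul_right _ hlen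
      · rintro S ⟨c, hc, T, hT, rfl⟩
        rw [swBnd_zero]
        exact (hg c hc).1 T hT
    · rw [swReduce_zero_true', swBnd_succ]
      simp only [swForm.kids, swForm.node, List.mem_flatMap, List.mem_map, Finset.mem_toList, List.length_flatMap]
      have hg : ∀ c ∈ f.kids, (∀ T ∈ swDnf V₁ x c.clauses, #T ≤ r) ∧
          #(swDnf V₁ x c.clauses) ≤ 2 ^ r := by
        intro c hc
        have h := hgood _ (hleaf c hc)
        simp only [Bool.not_true] at h
        exact ⟨(swDnf_bnd_of_good V₁ x c.clauses v₀ h).1, card_swDnf_le_of_good V₁ x c.clauses v₀ h⟩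
      refine ⟨?_, ?_⟩
      · calc (f.kids.map fun c => (((swDnf V₁ x c.clauses).toList.map swForm.leaf).length)).sum
            ≤ (f.kids.map fun _ => 2 ^ r).sum := by
              refine List.sum_le_sum fun c hc => ?_
              rw [List.length_map, Finset.length_toList]
              exact (hg c hc).2
          _ = f.kids.length * 2 ^ r := by
              rw [List.map_const', List.sum_replicate, smul_eq_mul]
          _ ≤ M * 2 ^ r := Nat.mul_le_mul_right _ hlen
      · rintro S ⟨c, hc, T, hT, rfl⟩
        rw [swBnd_zero]
        exact (hg c hc).1 T hT
  | succ d ih =>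
    intro pol f hf hgood
    rw [swBnd_succ] at hf
    obtain ⟨hlen, hkids⟩ := hf
    rw [swReduce_succ, swBnd_succ]
    simp only [swForm.kids, swForm.node, List.mem_map, List.length_map]
    refine ⟨hlen.trans (Nat.le_mul_of_pos_right M (pow_pos (Nat.succ_pos _) _)), ?_⟩
    rintro g ⟨g', hg', rfl⟩
    refine ih (!pol) g' (hkids g' hg') fun p hp => hgood p ?_
    rw [swLeaves_succ, List.mem_flatMap]
    exact ⟨g', hg', hp⟩

/-! ### The bad event is rare -/

/-- Union bound over a list of events, summed over an outer index (cover form: no predicates, so that no decidability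
instances have to agree). [folklore] -/
theorem sum_card_le_length_mul_of_cover {ι β γ : Type*} [DecidableEq β] (s : Finset γ) (T : ι → γ → Finset β)
    (SW : ℕ) : ∀ (l : List ι) (S : γ → Finset β), (∀ i ∈ l, ∑ c ∈ s, #(T i c) ≤ SW) →
      (∀ c ∈ s, ∀ b ∈ S c, ∃ i ∈ l, b ∈ T i c) → ∑ c ∈ s, #(S c) ≤ l.length * SW := by
  intro l
  induction l with
  | nil =>
    intro S _ hcover
    rw [List.length_nil, zero_mul]
    refine le_of_eq (sum_eq_zero fun c hc => card_eq_zero.2 (eq_empty_of_forall_notMem fun b hb => ?_))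
    obtain ⟨i, hi, -⟩ := hcover c hc b hb
    simp at hi
  | cons i l ih =>
    intro S h hcover
    rw [List.length_cons]
    have hsplit : ∀ c ∈ s, #(S c) ≤ #(T i c) + #(S c \ T i c) := fun c _ =>
      calc #(S c) ≤ #(T i c ∪ (S c \ T i c)) := card_le_card fun b hb => by
              rw [mem_union, mem_sdiff]; tauto
        _ ≤ #(T i c) + #(S c \ T i c) := card_union_le _ _
    have hcover' : ∀ c ∈ s, ∀ b ∈ S c \ T i c, ∃ j ∈ l, b ∈ T j c := by
      intro c hc b hb
      rw [mem_sdiff] at hb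
      obtain ⟨j, hj, hjb⟩ := hcover c hc b hb.1
      rcases List.mem_cons.1 hj with rfl | hj
      · exact absurd hjb hb.2
      · exact ⟨j, hj, hjb⟩
    calc ∑ c ∈ s, #(S c) ≤ ∑ c ∈ s, (#(T i c) + #(S c \ T i c)) := sum_le_sum hsplit
      _ = ∑ c ∈ s, #(T i c) + ∑ c ∈ s, #(S c \ T i c) := sum_add_distrib
      _ ≤ SW + l.length * SW :=
          add_le_add (h i List.mem_cons_self) (ih _ (fun j hj => h j (List.mem_cons_of_mem _ hj)) hcover')
      _ = (l.length + 1) * SW := by ring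

open Classical in
/-- **The bad event of one level of reduction is rare.** For a level-`(d+2)` formula with fan-ins `≤ M` and sets of
`≤ L` slots: summed over the `n₁`-subsets `V₁ ⊆ V`, the inputs in the bad event number at most `M^{d+1}` times the
bound of the switching lemma. [cite: Beame1994, §3] -/
theorem swReduce_bad_count (V : Finset (Fin n)) (n₁ M L v₀ : ℕ) (hv₀ : 0 < v₀)
    (d : ℕ) (pol : Bool) (f : swForm n (d + 2)) (hf : swBnd M L (d + 2) f) :
    ∑ V₁ ∈ powersetCard n₁ V, #(univ.filter fun x : EdgeVec n => swBadAt V₁ x v₀ (d + 1) pol f) ≤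
      M ^ (d + 1) * (2 ^ Fintype.card (⊤ : SimpleGraph (Fin n)).edgeSet * (#V - v₀).choose (n₁ - v₀) *
        (2 ^ ((v₀ - 1).choose 2 + (v₀ - 1).choose 2) *
            (2 * (L + 1) ^ (2 * (v₀ - 1).choose 2)) ^ ((v₀ - 1).choose 2 + 1) + M * (2 * L).choose v₀)) := by
  have hleaves := swLeaves_bnd M L (d + 1) pol f hf
  have hlen := length_swLeaves_le M L (d + 1) pol f hf
  -- one leaf: the switching lemma (through the complement for the DNF leaves), then monotonicity in `|l| ≤ M`
  have hone : ∀ p ∈ swLeaves (d + 1) pol f, ∑ V₁ ∈ powersetCard n₁ V, #(univ.filter fun x : EdgeVec n =>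
      ∃ z : EdgeVec n, v₀ ≤ #(univ.filter fun v : Fin n =>
        ∃ e ∈ (swRun V₁ (if p.1 then (fun e => !x e) else x) z p.2 ∅).2, v ∈ (e : Sym2 (Fin n)))) ≤
      2 ^ Fintype.card (⊤ : SimpleGraph (Fin n)).edgeSet * (#V - v₀).choose (n₁ - v₀) *
        (2 ^ ((v₀ - 1).choose 2 + (v₀ - 1).choose 2) *
            (2 * (L + 1) ^ (2 * (v₀ - 1).choose 2)) ^ ((v₀ - 1).choose 2 + 1) + M * (2 * L).choose v₀) := by
    rintro ⟨q, l⟩ hp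
    obtain ⟨hpM, hpL⟩ := hleaves _ hp
    have h := switch_bad_count V n₁ L v₀ hv₀ l hpL
    have hmono : 2 ^ Fintype.card (⊤ : SimpleGraph (Fin n)).edgeSet * (#V - v₀).choose (n₁ - v₀) *
        (2 ^ ((v₀ - 1).choose 2 + (v₀ - 1).choose 2) *
            (2 * (L + 1) ^ (2 * (v₀ - 1).choose 2)) ^ ((v₀ - 1).choose 2 + 1) + l.length * (2 * L).choose v₀) ≤
        2 ^ Fintype.card (⊤ : SimpleGraph (Fin n)).edgeSet * (#V - v₀).choose (n₁ - v₀) *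
        (2 ^ ((v₀ - 1).choose 2 + (v₀ - 1).choose 2) *
            (2 * (L + 1) ^ (2 * (v₀ - 1).choose 2)) ^ ((v₀ - 1).choose 2 + 1) + M * (2 * L).choose v₀) :=
      Nat.mul_le_mul_left _ (Nat.add_le_add_left (Nat.mul_le_mul_right _ hpM) _)
    cases q with
    | false => exact h.trans hmono
    | true =>
      have hc : ∀ V₁ : Finset (Fin n), #(univ.filter fun x : EdgeVec n =>
          ∃ z : EdgeVec n, v₀ ≤ #(univ.filter fun v : Fin n =>
            ∃ e ∈ (swRun V₁ (if true then (fun e => !x e) else x) z l ∅).2, v ∈ (e : Sym2 (Fin n)))) =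
          #(univ.filter fun x : EdgeVec n => ∃ z : EdgeVec n, v₀ ≤ #(univ.filter fun v : Fin n =>
            ∃ e ∈ (swRun V₁ x z l ∅).2, v ∈ (e : Sym2 (Fin n)))) := fun V₁ =>
        (switch_bad_count_compl V₁ l v₀)
      exact le_trans (le_of_eq (sum_congr rfl fun V₁ _ => hc V₁)) (h.trans hmono)
  -- union over the leaves (cover form)
  have hu := sum_card_le_length_mul_of_cover (powersetCard n₁ V)
    (fun (p : Bool × List (Finset (⊤ : SimpleGraph (Fin n)).edgeSet)) (V₁ : Finset (Fin n)) =>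
      univ.filter fun x : EdgeVec n => ∃ z : EdgeVec n, v₀ ≤ #(univ.filter fun v : Fin n =>
        ∃ e ∈ (swRun V₁ (if p.1 then (fun e => !x e) else x) z p.2 ∅).2, v ∈ (e : Sym2 (Fin n))))
    _ (swLeaves (d + 1) pol f) (fun V₁ => univ.filter fun x : EdgeVec n => swBadAt V₁ x v₀ (d + 1) pol f) hone
    (fun V₁ _ x hx => by
      rw [mem_filter] at hx
      obtain ⟨p, hp, z, hz⟩ := hx.2
      exact ⟨p, hp, mem_filter.2 ⟨mem_univ _, z, hz⟩⟩)
  exact hu.trans (Nat.mul_le_mul_right _ hlen)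

/-- Registered stub `stub_formReduce` of the AC⁰ line, stage C (side result of stmt-PneNP-18027, seat 0). [folklore] -/
theorem stub_formReduce : ∀ (M d : ℕ) (l : List ℕ), l.length ≤ M → (∀ x ∈ l, x ≤ M ^ d) → l.sum ≤ M ^ (d + 1) := by
  intro M d l hl hx
  calc l.sum ≤ l.length * M ^ d := by simpa [smul_eq_mul] using List.sum_le_card_nsmul l (M ^ d) hx
    _ ≤ M * M ^ d := Nat.mul_le_mul_right _ hl
    _ = M ^ (d + 1) := (pow_succ' M d).symm

end Summit.PneNP.PneNP.Theorems
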